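import Mathlib
import Literature.Analysis.FluidPDE.SelfSimilarEulerProfile
import Summits.NavierStokesRegularity.NavierStokesRegularity.Theorems.EulerZoomLiouvillePowerGaugeEulerLiouvilleWeakCasimirRaceTools
import HarnessLib

/-!
# Crux `EulerZoomLiouville.PowerGaugeEulerLiouville` (stmt-NavierStokesRegularity-19832), weak stratum, line `weak_axisym` (ns-idea-11 g9):
# THE CASIMIR RACE IN ONE INEQUALITY (toward `stub_casimirRace`, X2)

Route №10 `EulerZoomLiouville` (NavierStokesRegularity), crux E = stmt-NavierStokesRegularity-19832; width seat ns-ezl-w1 g9 under the LEAD ns-typeII-p2,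
on the tools file `…WeakCasimirRaceTools` of ns-ezl-w2 g6 (fixed renormalisation `β_q`, radial tests `ψ_R`), used AT `q = 1` ONLY: `β₁(s) = (1+s²)^{1/2} − 1`
satisfies the race inequality `β₁ ≤ sβ₁′`, so `c₁ = 3γ − (1+γ) = 2γ − 1 < 0` — the admissible damping IS the window `ρ > 0`; no fast set, no Hölder beyond
Cauchy–Schwarz, no `ε → 0`.

* `locallyIntegrable_of_integrableOn_ball`, `aestronglyMeasurable_of_memLp_ball`, `memLp_drift_ball` — bookkeeping;
* `casimir_mass_le` — **THE RACE**: for `0 ≤ γ ≤ ½`, `V, η ∈ L²_loc`, `η` a renormalised solution of the damped Casimir law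
  `∫ β(η)(3γψ + Dψ[W]) = ∫ ψ(1+γ)ηβ′(η)` (`W = γy + V`): `(1 − 2γ)∫_{B_R} β₁(η) ≤ (4M/R)·‖η‖_{L²(B_{2R})}·‖V‖_{L²(B_{2R})}` for every `R > 0`.
The member `casimirRace` (= `Sig.stub_casimirRace` δ-unfolded) is the sequel file `…WeakCasimirRace`.
[folklore; Ukhovskii–Yudovich 1968 / Majda–Bertozzi §4.3 (the Casimir `ω_θ/r`); DiPernaLions1989 §II; tree ROUND-37 `NeedleRace`]

WHAT THIS IS NOT: not NS, not E, not X2 itself — a class-free inequality; 19832 is OPEN.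
-/

noncomputable section

-- flat `Theorems/<Route><Decl>…` files of one crux share the namespace of the crux (tree convention)
set_option linter.dupNamespace false

open MeasureTheory Set Filter Topology Metric Function TopologicalSpace
open scoped ENNReal NNReal RealInnerProductSpace ContDiff

namespace Summit.NavierStokesRegularity.NavierStokesRegularity.Theorems.PowerGaugeEulerLiouville.WeakAxisym

open Literature.Analysis Literature.Analysis.FunctionSpaces Literature.Analysis.FluidPDE
open Summit.NavierStokesRegularity.NavierStokesRegularity.Theorems.PowerGaugeEulerLiouville

/-! ### Local integrability bookkeeping -/

section Tools

variable {V W : EuclideanSpace ℝ (Fin 3) → EuclideanSpace ℝ (Fin 3)} {η : EuclideanSpace ℝ (Fin 3) → ℝ}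

/-- A function integrable on every ball about the origin is locally integrable. -/
theorem locallyIntegrable_of_integrableOn_ball {F : Type*} [NormedAddCommGroup F] {f : EuclideanSpace ℝ (Fin 3) → F}
    (h : ∀ r : ℝ, IntegrableOn f (ball (0 : EuclideanSpace ℝ (Fin 3)) r) volume) : LocallyIntegrable f volume := by
  refine (locallyIntegrable_iff).2 fun K hK => ?_
  obtain ⟨r, hr⟩ := hK.isBounded.subset_ball (0 : EuclideanSpace ℝ (Fin 3))
  exact (h r).mono_set hr

/-- A function in `L²` of every ball about the origin is a.e.-strongly measurable. -/
theorem aestronglyMeasurable_of_memLp_ball {f : EuclideanSpace ℝ (Fin 3) → ℝ}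
    (h : ∀ r : ℝ, MemLp f 2 (volume.restrict (ball (0 : EuclideanSpace ℝ (Fin 3)) r))) : AEStronglyMeasurable f volume := by
  have hU : (⋃ n : ℕ, ball (0 : EuclideanSpace ℝ (Fin 3)) (n : ℝ)) = univ := iUnion_ball_nat 0
  have h' : AEStronglyMeasurable f (volume.restrict (⋃ n : ℕ, ball (0 : EuclideanSpace ℝ (Fin 3)) (n : ℝ))) :=
    (aestronglyMeasurable_iUnion_iff).2 fun n => (h n).aestronglyMeasurable
  rwa [hU, Measure.restrict_univ] at h'

/-- The similarity drift `y ↦ γ(y − 0)` is in `L²` of every ball. -/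
theorem memLp_drift_ball (γ r : ℝ) :
    MemLp (fun y : EuclideanSpace ℝ (Fin 3) => γ • (y - 0)) 2 (volume.restrict (ball (0 : EuclideanSpace ℝ (Fin 3)) r)) := by
  haveI : IsFiniteMeasure ((volume : Measure (EuclideanSpace ℝ (Fin 3))).restrict (ball (0 : EuclideanSpace ℝ (Fin 3)) r)) :=
    isFiniteMeasure_restrict.2 measure_ball_lt_top.ne
  refine MemLp.of_bound ((continuous_id.sub continuous_const).const_smul γ).aestronglyMeasurable (‖γ‖ * |r|) ?_
  filter_upwards [ae_restrict_mem measurableSet_ball] with y hy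
  rw [norm_smul, sub_zero]
  exact mul_le_mul_of_nonneg_left ((mem_ball_zero_iff.1 hy).le.trans (le_abs_self r)) (norm_nonneg _)

/-- `η·‖W‖ ∈ L¹_loc` for `η, W ∈ L²_loc`. -/
theorem locallyIntegrable_mul_norm (hη2 : ∀ r : ℝ, MemLp η 2 (volume.restrict (ball (0 : EuclideanSpace ℝ (Fin 3)) r)))
    (hW2 : ∀ r : ℝ, MemLp W 2 (volume.restrict (ball (0 : EuclideanSpace ℝ (Fin 3)) r))) :
    LocallyIntegrable (fun y => η y * ‖W y‖) volume :=
  locallyIntegrable_of_integrableOn_ball fun r => (hη2 r).integrable_mul (hW2 r).norm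

end Tools

/-! ### The race in one inequality -/

section Race

variable {γ : ℝ} {V : EuclideanSpace ℝ (Fin 3) → EuclideanSpace ℝ (Fin 3)} {η : EuclideanSpace ℝ (Fin 3) → ℝ}

/-- **THE CASIMIR RACE IN ONE INEQUALITY.**  Let `0 ≤ γ ≤ ½`, `V, η ∈ L²_loc(ℝ³)`, `W = γy + V`, and let `η` be a renormalised solution of the damped
Casimir law: `∫ β(η)(3γψ + Dψ[W]) = ∫ ψ(1+γ)ηβ′(η)` for every `β ∈ C¹` with `β′` bounded and every test `ψ`.  Then for every `R > 0`
`(1 − 2γ) ∫_{B_R} ((1+η²)^{1/2} − 1) ≤ (4M/R) · (∫_{B_{2R}} η²)^{1/2} · (∫_{B_{2R}} ‖V‖²)^{1/2}`, `M` a bound of `smoothTransition′`.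
(Renormalise with `β₁ = (1+s²)^{1/2} − 1`, test with `ψ_R`; race inequality `β₁ ≤ sβ₁′` ⇒ `(1−2γ)∫ψ_Rβ₁(η) ≤ ∫β₁(η)Dψ_R[W]`; signed flux estimate
`Dψ_R(y)[γy + v] ≤ (4M/R)‖v‖` ⇒ `≤ (4M/R)∫_{B_{2R}}β₁(η)‖V‖`; Cauchy–Schwarz and `β₁² ≤ s²`.) [folklore] -/
theorem casimir_mass_le (hγ : 0 ≤ γ) (hγh : γ ≤ 1 / 2) (hVl : LocallyIntegrable V volume)
    (hV2 : ∀ r : ℝ, MemLp V 2 (volume.restrict (ball (0 : EuclideanSpace ℝ (Fin 3)) r)))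
    (hηm : AEStronglyMeasurable η volume) (hη2 : ∀ r : ℝ, MemLp η 2 (volume.restrict (ball (0 : EuclideanSpace ℝ (Fin 3)) r)))
    (hren : ∀ β : ℝ → ℝ, ContDiff ℝ 1 β → (∃ C : ℝ, ∀ s : ℝ, ‖deriv β s‖ ≤ C) →
      ∀ ψ : EuclideanSpace ℝ (Fin 3) → ℝ, IsTestFunctionOn (⊤ : Opens (EuclideanSpace ℝ (Fin 3))) ψ →
        ∫ y, β (η y) * (3 * γ * ψ y + fderiv ℝ ψ y (selfSimilarTransport γ 0 V y)) =
          ∫ y, ψ y * ((1 + γ) * η y * deriv β (η y)))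
    {M : ℝ} (hM0 : 0 ≤ M) (hM : ∀ t : ℝ, deriv Real.smoothTransition t ≤ M) {R : ℝ} (hR : 0 < R) :
    (1 - 2 * γ) * ∫ y in ball (0 : EuclideanSpace ℝ (Fin 3)) R, ((1 + η y ^ 2) ^ ((1 : ℝ) / 2) - 1) ≤
      4 * M / R * (√(∫ y in ball (0 : EuclideanSpace ℝ (Fin 3)) (2 * R), η y ^ 2) *
        √(∫ y in ball (0 : EuclideanSpace ℝ (Fin 3)) (2 * R), ‖V y‖ ^ 2)) := by
  -- ### notation
  set β : ℝ → ℝ := fun s => (1 + s ^ 2) ^ ((1 : ℝ) / 2) - 1 with hβ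
  have hβ0 : ∀ s, 0 ≤ β s := fun s => betaq_nonneg zero_le_one s
  have hβle : ∀ s, β s ≤ |s| := fun s => (betaq_le_abs_rpow zero_le_one (by norm_num) s).trans_eq (Real.rpow_one _)
  have hβsq : ∀ s, β s ^ 2 ≤ s ^ 2 := fun s => (pow_le_pow_left₀ (hβ0 s) (hβle s) 2).trans_eq (sq_abs s)
  have hβ' : ∀ s, ‖deriv β s‖ ≤ 1 := fun s => abs_deriv_betaq_le zero_le_one le_rfl s
  have hdamp : ∀ s, (1 - 2 * γ) * β s ≤ (1 + γ) * s * deriv β s - 3 * γ * β s := fun s => by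
    have h := mul_betaq_le_mul_deriv (zero_le_one) (by norm_num : (1 : ℝ) ≤ 2) s
    rw [one_mul] at h
    nlinarith [h, hγ, hβ0 s]
  set ψ : EuclideanSpace ℝ (Fin 3) → ℝ := fun y => Real.smoothTransition (2 - (R ^ 2)⁻¹ * ‖y‖ ^ 2) with hψ
  set W : EuclideanSpace ℝ (Fin 3) → EuclideanSpace ℝ (Fin 3) := selfSimilarTransport γ 0 V with hW
  set B : Set (EuclideanSpace ℝ (Fin 3)) := ball (0 : EuclideanSpace ℝ (Fin 3)) (2 * R) with hB
  have hψt : IsTestFunctionOn (⊤ : Opens (EuclideanSpace ℝ (Fin 3))) ψ := isTestFunctionOn_psiR hR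
  have hψc : Continuous ψ := hψt.contDiff.continuous
  have hψ01 : ∀ y, ψ y ∈ Icc (0 : ℝ) 1 := fun y => ⟨psiR_nonneg R y, psiR_le_one R y⟩
  have hDψc : Continuous (fderiv ℝ ψ) := hψt.contDiff.continuous_fderiv (by simp)
  have hDψs : HasCompactSupport (fderiv ℝ ψ) := hψt.hasCompactSupport.fderiv (𝕜 := ℝ)
  -- ### measurability and local integrability
  have hηl : LocallyIntegrable η volume := by
    refine locallyIntegrable_of_integrableOn_ball fun r => ?_
    haveI : IsFiniteMeasure ((volume : Measure (EuclideanSpace ℝ (Fin 3))).restrict (ball (0 : EuclideanSpace ℝ (Fin 3)) r)) :=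
      isFiniteMeasure_restrict.2 measure_ball_lt_top.ne
    exact (hη2 r).integrable one_le_two
  have hηln : LocallyIntegrable (fun y => ‖η y‖) volume := fun x => (hηl x).norm
  have hβc : Continuous β := (contDiff_betaq 1).continuous
  have hβ'c : Continuous (deriv β) := (contDiff_betaq 1).continuous_deriv le_rfl
  have hβηm : AEStronglyMeasurable (fun y => β (η y)) volume := hβc.comp_aestronglyMeasurable hηm
  have hWl : LocallyIntegrable W volume := by
    have h1 : LocallyIntegrable (fun y : EuclideanSpace ℝ (Fin 3) => γ • (y - 0)) volume :=
      ((continuous_id.sub continuous_const).const_smul γ).locallyIntegrable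
    exact h1.add hVl
  have hW2 : ∀ r : ℝ, MemLp W 2 (volume.restrict (ball (0 : EuclideanSpace ℝ (Fin 3)) r)) := fun r =>
    (memLp_drift_ball γ r).add (hV2 r)
  have hηW : LocallyIntegrable (fun y => η y * ‖W y‖) volume := locallyIntegrable_mul_norm hη2 hW2
  have hηWn : LocallyIntegrable (fun y => ‖η y * ‖W y‖‖) volume := fun x => (hηW x).norm
  have hDψW : AEStronglyMeasurable (fun y => fderiv ℝ ψ y (W y)) volume :=
    Continuous.comp_aestronglyMeasurable₂ (g := fun (L : EuclideanSpace ℝ (Fin 3) →L[ℝ] ℝ) (v : EuclideanSpace ℝ (Fin 3)) => L v)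
      (isBoundedBilinearMap_apply (𝕜 := ℝ) (E := EuclideanSpace ℝ (Fin 3)) (F := ℝ)).continuous hDψc.aestronglyMeasurable
      hWl.aestronglyMeasurable
  -- ### the four integrable products
  -- (I4) `ψ β(η)`
  have hI4 : Integrable (fun y => ψ y * β (η y)) volume := by
    refine Integrable.mono' (hηln.integrable_smul_left_of_hasCompactSupport hψc.norm hψt.hasCompactSupport.norm)
      (hψc.aestronglyMeasurable.mul hβηm) (Eventually.of_forall fun y => ?_)
    rw [norm_mul, smul_eq_mul]
    refine mul_le_mul_of_nonneg_left ?_ (norm_nonneg _)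
    rw [Real.norm_eq_abs, Real.norm_eq_abs, abs_of_nonneg (hβ0 _)]
    exact hβle _
  -- (I3) `ψ (1+γ) η β′(η)`
  have hI3 : Integrable (fun y => ψ y * ((1 + γ) * η y * deriv β (η y))) volume := by
    refine Integrable.mono' ((hηln.integrable_smul_left_of_hasCompactSupport hψc.norm hψt.hasCompactSupport.norm).const_mul (1 + γ))
      (hψc.aestronglyMeasurable.mul (((aestronglyMeasurable_const (b := 1 + γ)).mul hηm).mul (hβ'c.comp_aestronglyMeasurable hηm)))
      (Eventually.of_forall fun y => ?_)
    rw [norm_mul, norm_mul, norm_mul, smul_eq_mul, Real.norm_of_nonneg (by linarith : (0 : ℝ) ≤ 1 + γ)]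
    have h1 := hβ' (η y)
    calc ‖ψ y‖ * ((1 + γ) * ‖η y‖ * ‖deriv β (η y)‖) ≤ ‖ψ y‖ * ((1 + γ) * ‖η y‖ * 1) := by gcongr
      _ = (1 + γ) * (‖ψ y‖ * ‖η y‖) := by ring
  -- (I2) `β(η) Dψ[W]`
  have hI2 : Integrable (fun y => β (η y) * fderiv ℝ ψ y (W y)) volume := by
    refine Integrable.mono' (hηWn.integrable_smul_left_of_hasCompactSupport hDψc.norm hDψs.norm) (hβηm.mul hDψW)
      (Eventually.of_forall fun y => ?_)
    rw [norm_mul, smul_eq_mul, Real.norm_eq_abs, abs_of_nonneg (hβ0 _), norm_mul, norm_norm]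
    calc β (η y) * ‖fderiv ℝ ψ y (W y)‖ ≤ |η y| * (‖fderiv ℝ ψ y‖ * ‖W y‖) :=
          mul_le_mul (hβle _) ((fderiv ℝ ψ y).le_opNorm _) (norm_nonneg _) (abs_nonneg _)
      _ = ‖fderiv ℝ ψ y‖ * (‖η y‖ * ‖W y‖) := by rw [Real.norm_eq_abs]; ring
  -- (I1) `β(η) 3γψ`
  have hI1 : Integrable (fun y => β (η y) * (3 * γ * ψ y)) volume := by
    have := hI4.const_mul (3 * γ)
    refine this.congr (Eventually.of_forall fun y => ?_)
    ring
  -- ### the renormalised identity and the race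
  have hid := hren β (contDiff_betaq 1) ⟨1, hβ'⟩ ψ hψt
  have hsplit : ∫ y, β (η y) * (3 * γ * ψ y + fderiv ℝ ψ y (W y)) =
      (∫ y, β (η y) * (3 * γ * ψ y)) + ∫ y, β (η y) * fderiv ℝ ψ y (W y) := by
    rw [← integral_add hI1 hI2]
    refine integral_congr_ae (Eventually.of_forall fun y => ?_)
    ring
  have hrace : (1 - 2 * γ) * ∫ y, ψ y * β (η y) ≤ ∫ y, β (η y) * fderiv ℝ ψ y (W y) := by
    have h1 : ∫ y, β (η y) * fderiv ℝ ψ y (W y) = (∫ y, ψ y * ((1 + γ) * η y * deriv β (η y))) - ∫ y, β (η y) * (3 * γ * ψ y) := by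
      rw [← hid, hsplit]; ring
    have h2 : (1 - 2 * γ) * ∫ y, ψ y * β (η y) = ∫ y, (1 - 2 * γ) * (ψ y * β (η y)) := (integral_const_mul _ _).symm
    rw [h1, h2, ← integral_sub hI3 hI1]
    refine integral_mono (hI4.const_mul _) (hI3.sub hI1) fun y => ?_
    have hd := hdamp (η y)
    have hψ0 : 0 ≤ ψ y := (hψ01 y).1
    nlinarith [mul_le_mul_of_nonneg_left hd hψ0]
  -- ### the signed flux estimate, integrated over `B = B(0, 2R)`
  have hflux : ∫ y, β (η y) * fderiv ℝ ψ y (W y) ≤ 4 * M / R * ∫ y in B, β (η y) * ‖V y‖ := by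
    have hzero : ∀ y ∉ B, β (η y) * fderiv ℝ ψ y (W y) = 0 := by
      intro y hy
      rw [hB, mem_ball_zero_iff, not_lt] at hy
      rw [fderiv_psiR_apply_eq_zero hR hy, mul_zero]
    rw [← setIntegral_eq_integral_of_forall_compl_eq_zero hzero, ← integral_const_mul]
    have hβV : IntegrableOn (fun y => β (η y) * ‖V y‖) B volume := by
      refine Integrable.mono' ((hη2 (2 * R)).norm.integrable_mul (hV2 (2 * R)).norm) (hβηm.mul hVl.aestronglyMeasurable.norm).restrict
        (Eventually.of_forall fun y => ?_)
      rw [norm_mul, Real.norm_eq_abs, abs_of_nonneg (hβ0 _), norm_norm]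
      exact mul_le_mul_of_nonneg_right ((hβle _).trans_eq (Real.norm_eq_abs _).symm) (norm_nonneg _)
    refine setIntegral_mono hI2.integrableOn (hβV.const_mul _) fun y => ?_
    have hWy : W y = γ • y + V y := by rw [hW, selfSimilarTransport_apply, sub_zero]
    rw [hWy]
    calc β (η y) * fderiv ℝ ψ y (γ • y + V y) ≤ β (η y) * (4 * M / R * ‖V y‖) :=
          mul_le_mul_of_nonneg_left (fderiv_psiR_transport_le hR hγ hM0 hM y (V y)) (hβ0 _)
      _ = 4 * M / R * (β (η y) * ‖V y‖) := by ring
  -- ### Cauchy–Schwarz on `B` and `β(η)² ≤ η²`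
  have hCS : ∫ y in B, β (η y) * ‖V y‖ ≤ √(∫ y in B, η y ^ 2) * √(∫ y in B, ‖V y‖ ^ 2) := by
    haveI : IsFiniteMeasure ((volume : Measure (EuclideanSpace ℝ (Fin 3))).restrict B) :=
      isFiniteMeasure_restrict.2 measure_ball_lt_top.ne
    have hβη2 : MemLp (fun y => β (η y)) 2 (volume.restrict B) :=
      MemLp.of_le (hη2 (2 * R)) hβηm.restrict (Eventually.of_forall fun y => by
        rw [Real.norm_eq_abs, abs_of_nonneg (hβ0 _), Real.norm_eq_abs]; exact hβle _)
    have h := integral_mul_le_Lp_mul_Lq_of_nonneg (μ := volume.restrict B) Real.HolderConjugate.two_two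
      (f := fun y => β (η y)) (g := fun y => ‖V y‖) (Eventually.of_forall fun y => hβ0 _)
      (Eventually.of_forall fun _ => norm_nonneg _) (by simpa using hβη2) (by simpa using (hV2 (2 * R)).norm)
    simp only [Real.rpow_two] at h
    rw [← Real.sqrt_eq_rpow, ← Real.sqrt_eq_rpow] at h
    refine h.trans (mul_le_mul_of_nonneg_right (Real.sqrt_le_sqrt ?_) (Real.sqrt_nonneg _))
    exact integral_mono_of_nonneg (Eventually.of_forall fun y => sq_nonneg _) (hη2 (2 * R)).integrable_sq
      (Eventually.of_forall fun y => hβsq _)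
  -- ### the mass on `B_R` sits under `ψ_R`
  have hmass : ∫ y in ball (0 : EuclideanSpace ℝ (Fin 3)) R, β (η y) ≤ ∫ y, ψ y * β (η y) := by
    have h1 : ∫ y in ball (0 : EuclideanSpace ℝ (Fin 3)) R, β (η y) = ∫ y in ball (0 : EuclideanSpace ℝ (Fin 3)) R, ψ y * β (η y) := by
      refine setIntegral_congr_fun measurableSet_ball fun y hy => ?_
      rw [hψ]; dsimp only
      rw [psiR_eq_one_of_le hR (mem_ball_zero_iff.1 hy).le, one_mul]
    rw [h1]
    exact setIntegral_le_integral hI4 (Eventually.of_forall fun y => mul_nonneg (hψ01 y).1 (hβ0 _))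
  -- ### assemble
  have h12 : 0 ≤ 1 - 2 * γ := by linarith
  calc (1 - 2 * γ) * ∫ y in ball (0 : EuclideanSpace ℝ (Fin 3)) R, β (η y)
      ≤ (1 - 2 * γ) * ∫ y, ψ y * β (η y) := mul_le_mul_of_nonneg_left hmass h12
    _ ≤ ∫ y, β (η y) * fderiv ℝ ψ y (W y) := hrace
    _ ≤ 4 * M / R * ∫ y in B, β (η y) * ‖V y‖ := hflux
    _ ≤ 4 * M / R * (√(∫ y in B, η y ^ 2) * √(∫ y in B, ‖V y‖ ^ 2)) := mul_le_mul_of_nonneg_left hCS (by positivity)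

end Race

end Summit.NavierStokesRegularity.NavierStokesRegularity.Theorems.PowerGaugeEulerLiouville.WeakAxisym

end
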